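import Mathlib
import Summits.CriticalPhenomena.CardyFormulaZ2.Theorems.CardyMagicRigidityNestingRigidityBondLoopTraversalTransfer
import Literature.Probability.Percolation.ExplorationPolygon
import HarnessLib

/-!
# (H1) for bond-`ℤ²` interface loops, brick 2: side components of the rounded Jordan loop

Crux `Summit.CriticalPhenomena.CardyFormulaZ2.Theses.CardyMagicRigidity.NestingRigidity`
(stmt-CriticalPhenomena-4835), line `positive-cone-weight-doubling`, stub `bond_loop_traversalBound`.
Planar bookkeeping for the primal side of the rounded loop `Λ = OrbitPolygon.loop β p δ` of the orbit of a
periodic corner `p` (continuation of brick 1, `…BondLoopTraversalTransfer`):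

* `BondLoopH1.mem_dartPiece_of_mem_halfDiag` — the trace of `Λ` meets the (scaled) half-diagonal of the
  `m`-th corner, the segment from the primal vertex `δ·cv m` to the centre of the face `cf m`, only along
  the `m`-th dart piece (free-segment facts of `MedialPerturbation.lean`, as for the exploration path in
  `InterfaceTraversalBound.lean`);
* `BondLoopH1.exists_touchPoint` — the first trace point on that half-diagonal: a point of the `m`-th dart
  piece, within `δ` of `δ·cv m`, in the closure of the component of `δ·cv m` in `U ∖ trace Λ` whenever
  `B̄(δ·cv m, δ) ⊆ U` (the component of the primal vertex of a dart TOUCHES the trace on that dart);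
* `BondLoopH1.meshPoint_cv_mem_connectedComponentIn` — along a stretch of darts whose vertices have their
  `δ`-neighbourhoods in `A`, the primal vertices lie in one component of `A ∖ trace Λ` (consecutive ones are
  equal or joined by an OPEN edge, which the rounded loop misses, `OrbitPolygon.loop_not_mem_smul_edgeTrace`).

Registered anchor: `bondLoopH1_exists_touchPoint`.
-/

noncomputable section

open MeasureTheory Set Filter Metric TopologicalSpace Function
open scoped Topology ENNReal NNReal unitInterval

namespace Summit.CriticalPhenomena.CardyFormulaZ2.Cruxes.NestingRigidity.PositiveConeWeightDoubling

open Literature.Probability.RandomPlanarGeometry Literature.Probability.Percolation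
  Literature.Probability.LatticeModels

/-! Local notations (no definitions are introduced): the rounded Jordan loop of the orbit of the corner `p`
of `β` at mesh `δ`, read on `[0, 1]`, and the index `⌊Q t⌋` of the current dart at time `t`. -/
local notation3 "RC[" β ", " p ", " δ "]" =>
  (Curve.ofPeriodic (OrbitPolygon.loop β p δ) OrbitPolygon.continuous_loop : Curve ℂ)
local notation3 "uIdx[" Q ", " t "]" => ⌊(Q : ℝ) * ((t : unitInterval) : ℝ)⌋₊

namespace BondLoopH1

variable {β : BondConfig (Site 2)} {p : Site 2 × Fin 4} {δ : ℝ}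

/-! ### The trace meets a half-diagonal only along its dart piece -/

/-- **Free segment**: a point of the trace of the rounded loop lying (in lattice units) on the half-diagonal
of the `m`-th corner lies on the `m`-th dart piece (other dart pieces and all connectors miss it).
[cite: Smirnov2001, §2] -/
theorem mem_dartPiece_of_mem_halfDiag (hp : p ∈ periodicPts (nextCorner β)) (hδ : 0 < δ) {m : ℕ} {z : ℂ}
    (hz : z ∈ range (OrbitPolygon.loop β p δ))
    (hz' : δ⁻¹ • z ∈ halfDiag (OrbitPolygon.cv β p m) (OrbitPolygon.cf β p m)) :
    z ∈ OrbitPolygon.dartPiece β p δ m := by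
  obtain ⟨t, rfl⟩ := hz
  rcases OrbitPolygon.loop_mem hp t with ⟨j, hj⟩ | ⟨j, hj⟩
  · have hj' : δ⁻¹ • OrbitPolygon.loop β p δ t ∈
        dartSeg (OrbitPolygon.cv β p j) (OrbitPolygon.cf β p j) := by
      rw [OrbitPolygon.dartPiece_eq δ, Set.mem_smul_set_iff_inv_smul_mem₀ hδ.ne'] at hj
      exact hj
    obtain ⟨hv, hf⟩ := eq_of_dartSeg_inter_halfDiag (OrbitPolygon.isCorner m) (OrbitPolygon.isCorner j)
      ⟨_, hj', hz'⟩
    have e : OrbitPolygon.dartPiece β p δ j = OrbitPolygon.dartPiece β p δ m := by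
      simp only [OrbitPolygon.dartPiece, OrbitPolygon.pS, OrbitPolygon.pT, hv, hf]
    rw [← e]
    exact hj
  · exfalso
    obtain ⟨I₁, J₁, -, -, -, -, hcase⟩ := OrbitPolygon.connPiece_data hδ (Nat.le_add_left 1 j) hj
    rcases hcase with ⟨-, -, -, -, hshape, -⟩ | ⟨-, -, -, -, hshape, -, -⟩
    · exact hshape.not_mem_halfDiag (OrbitPolygon.isCorner m) hz'
    · exact hshape.not_mem_halfDiag (OrbitPolygon.isCorner m) hz'

/-- The primal vertex of a dart is off the trace of the rounded loop. [folklore] -/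
theorem meshPoint_cv_not_mem_range (hp : p ∈ periodicPts (nextCorner β)) (hδ : 0 < δ) (m : ℕ) :
    meshPoint δ (OrbitPolygon.cv β p m) ∉ range (OrbitPolygon.loop β p δ) :=
  meshPoint_not_mem_range_loop hp hδ _

/-- The trace of the rounded loop is closed. [folklore] -/
theorem isClosed_range_loop (hp : p ∈ periodicPts (nextCorner β)) (δ : ℝ) :
    IsClosed (range (OrbitPolygon.loop β p δ)) := by
  rw [OrbitPolygon.range_loop_eq hp]
  exact isClosed_biUnion_finset fun m _ ↦ OrbitPolygon.isClosed_piece δ m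

/-- A dart piece lies on the trace. [folklore] -/
theorem dartPiece_subset_range (hp : p ∈ periodicPts (nextCorner β)) (δ : ℝ) (m : ℕ) :
    OrbitPolygon.dartPiece β p δ m ⊆ range (OrbitPolygon.loop β p δ) := by
  rw [← OrbitPolygon.segment_vtx_even]
  exact OrbitPolygon.piece_subset_range_loop hp δ (2 * m)

/-! ### The component of the primal vertex of a dart touches the trace on that dart -/

/-- **The touch point.** If the closed `δ`-ball about the primal vertex `P = δ·cv m` of dart `m` lies in
`U`, there is a point of the `m`-th dart piece, within `δ` of `P`, in the closure of the component of `P`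
in `U` minus the trace: the first trace point on the half-diagonal from `P` to the centre of the face
`cf m` (the half-open part before it is a connected subset of `U` off the trace).
[cite: AizenmanBurchardDuke1999, Appendix A] -/
theorem exists_touchPoint (hp : p ∈ periodicPts (nextCorner β)) (hδ : 0 < δ) {U : Set ℂ} (m : ℕ)
    (hball : closedBall (meshPoint δ (OrbitPolygon.cv β p m)) δ ⊆ U) :
    ∃ z ∈ OrbitPolygon.dartPiece β p δ m, dist z (meshPoint δ (OrbitPolygon.cv β p m)) ≤ δ ∧
      z ∈ closure (connectedComponentIn (U \ range (OrbitPolygon.loop β p δ))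
        (meshPoint δ (OrbitPolygon.cv β p m))) := by
  set v := OrbitPolygon.cv β p m with hv
  set f := OrbitPolygon.cf β p m with hf
  have hc : IsCorner v f := OrbitPolygon.isCorner m
  set P : ℂ := meshPoint δ v with hP
  set Fc : ℂ := δ • faceCenter f with hFc
  set Λ := OrbitPolygon.loop β p δ with hΛ
  have hPv : P = δ • Site.toComplex v := meshPoint_eq_smul δ v
  set g : ℝ → ℂ := fun θ ↦ AffineMap.lineMap P Fc θ with hg
  have hgc : Continuous g := AffineMap.lineMap_continuous
  -- points of the half-diagonal, in lattice units, and their distance to `P`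
  have hseg : ∀ θ ∈ Icc (0 : ℝ) 1, g θ ∈ segment ℝ P Fc := fun θ hθ ↦ by
    rw [segment_eq_image_lineMap]; exact ⟨θ, hθ, rfl⟩
  have hhalf : ∀ θ ∈ Icc (0 : ℝ) 1, δ⁻¹ • g θ ∈ halfDiag v f := fun θ hθ ↦ by
    rw [halfDiag, ← mem_segment_smul_iff hδ.ne', ← hPv]; exact hseg θ hθ
  have hdistFc : dist Fc P ≤ δ := by
    rw [hPv, hFc, dist_smul₀, Real.norm_eq_abs, abs_of_pos hδ]
    nlinarith [dist_faceCenter_toComplex_le hc]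
  have hdist : ∀ θ ∈ Icc (0 : ℝ) 1, dist (g θ) P ≤ δ := fun θ hθ ↦
    (dist_left_le_dist_of_mem_segment (hseg θ hθ)).trans (by rw [dist_comm]; exact hdistFc)
  -- the set of parameters whose point is on the trace
  set T : Set ℝ := {θ | θ ∈ Icc (0 : ℝ) 1 ∧ g θ ∈ range Λ} with hT
  have hTc : IsClosed T := isClosed_Icc.inter ((isClosed_range_loop hp δ).preimage hgc)
  have hTcpt : IsCompact T := isCompact_Icc.of_isClosed_subset hTc fun θ hθ ↦ hθ.1
  have hTne : T.Nonempty := by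
    obtain ⟨q, hq, hqo⟩ := exists_mem_dartSeg_mem_openSegment hc
    have hq' : δ • q ∈ OrbitPolygon.dartPiece β p δ m := by
      rw [OrbitPolygon.dartPiece_eq δ]; exact Set.smul_mem_smul_set hq
    have hqseg : δ • q ∈ segment ℝ P Fc := by
      rw [hPv, hFc, mem_segment_smul_iff hδ.ne', inv_smul_smul₀ hδ.ne']
      exact openSegment_subset_segment ℝ _ _ hqo
    rw [segment_eq_image_lineMap] at hqseg
    obtain ⟨θ, hθ, hθq⟩ := hqseg
    exact ⟨θ, hθ, by rw [show g θ = δ • q from hθq]; exact dartPiece_subset_range hp δ m hq'⟩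
  obtain ⟨θ₀, ⟨hθ₀I, hθ₀Λ⟩, hmin⟩ := hTcpt.exists_isLeast hTne
  -- `θ₀ > 0` since `P` is off the trace
  have hθ₀pos : 0 < θ₀ := by
    rcases eq_or_lt_of_le hθ₀I.1 with h | h
    · exfalso
      refine meshPoint_cv_not_mem_range hp hδ m ?_
      rw [← hv, ← hP, show P = g 0 by simp [hg], h]
      exact hθ₀Λ
    · exact h
  -- the touch point
  refine ⟨g θ₀, mem_dartPiece_of_mem_halfDiag hp hδ hθ₀Λ (hhalf θ₀ hθ₀I), hdist θ₀ hθ₀I, ?_⟩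
  -- the half-open part `g '' [0, θ₀)` is a connected subset of `U` off the trace containing `P`
  have hsub : g '' Ico (0 : ℝ) θ₀ ⊆ U \ range Λ := by
    rintro z ⟨θ, ⟨h0, h1⟩, rfl⟩
    have hθI : θ ∈ Icc (0 : ℝ) 1 := ⟨h0, h1.le.trans hθ₀I.2⟩
    refine ⟨hball (mem_closedBall.2 (hdist θ hθI)), fun hmem ↦ ?_⟩
    exact absurd (hmin ⟨hθI, hmem⟩) (not_le.2 h1)
  have hconn : IsPreconnected (g '' Ico (0 : ℝ) θ₀) := isPreconnected_Ico.image _ hgc.continuousOn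
  have hPmem : P ∈ g '' Ico (0 : ℝ) θ₀ := ⟨0, ⟨le_rfl, hθ₀pos⟩, by simp [hg]⟩
  have hS : g '' Ico (0 : ℝ) θ₀ ⊆ connectedComponentIn (U \ range Λ) P :=
    hconn.subset_connectedComponentIn hPmem hsub
  refine closure_mono hS (image_closure_subset_closure_image hgc ⟨θ₀, ?_, rfl⟩)
  rw [closure_Ico hθ₀pos.ne]
  exact ⟨hθ₀pos.le, le_rfl⟩

/-! ### Primal vertices of a stretch lie in one component -/

/-- **Consecutive primal vertices are joined off the trace**: the segment between the vertices of darts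
`j` and `j + 1` (a point at a vertex turn, an OPEN edge at a face turn) misses the rounded loop.
[cite: Smirnov2001, §2] -/
theorem segment_cv_disjoint_range (hp : p ∈ periodicPts (nextCorner β)) (hδ : 0 < δ) (j : ℕ) :
    Disjoint (segment ℝ (meshPoint δ (OrbitPolygon.cv β p j)) (meshPoint δ (OrbitPolygon.cv β p (j + 1))))
      (range (OrbitPolygon.loop β p δ)) := by
  refine Set.disjoint_left.2 fun z hz hzΛ ↦ ?_
  rcases OrbitPolygon.turn_cases' (β := β) (p := p) (i := j + 1) (Nat.le_add_left 1 j) with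
    ⟨hvv, -, -⟩ | ⟨-, -, hedge, hopen⟩
  · rw [Nat.add_sub_cancel] at hvv
    rw [hvv, segment_same] at hz
    rw [mem_singleton_iff.1 hz] at hzΛ
    exact meshPoint_cv_not_mem_range hp hδ _ hzΛ
  · rw [Nat.add_sub_cancel] at hedge
    have hE : cSrc (OrbitPolygon.corner β p (j + 1)) ∈ (zdGraph 2).edgeSet := by
      rw [OrbitPolygon.corner_succ, cSrc_nextCorner]; exact cTgt_mem_edgeSet _
    rw [hedge] at hE hopen
    have hadj : (zdGraph 2).Adj (OrbitPolygon.cv β p j) (OrbitPolygon.cv β p (j + 1)) :=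
      (SimpleGraph.mem_edgeSet _).1 hE
    obtain ⟨t, rfl⟩ := hzΛ
    refine OrbitPolygon.loop_not_mem_smul_edgeTrace hp hδ hadj hopen t ?_
    rw [edgeTrace_mk, smul_segment_eq, ← meshPoint_eq_smul, ← meshPoint_eq_smul]
    exact hz

/-- **Primal vertices of a stretch lie in one component.** If the `δ`-neighbourhoods of the primal
vertices of the darts `i₀, …, i₁` lie in `A`, then in `A` minus the trace of the rounded loop all these
vertices lie in the component of any one of them. [cite: AizenmanBurchardDuke1999, Appendix A] -/
theorem meshPoint_cv_mem_connectedComponentIn (hp : p ∈ periodicPts (nextCorner β)) (hδ : 0 < δ)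
    {A : Set ℂ} {i₀ i₁ : ℕ}
    (hball : ∀ i, i₀ ≤ i → i ≤ i₁ → closedBall (meshPoint δ (OrbitPolygon.cv β p i)) δ ⊆ A)
    {i m : ℕ} (hi₀ : i₀ ≤ i) (hi : i ≤ i₁) (hm₀ : i₀ ≤ m) (hm : m ≤ i₁) :
    meshPoint δ (OrbitPolygon.cv β p i) ∈
      connectedComponentIn (A \ range (OrbitPolygon.loop β p δ)) (meshPoint δ (OrbitPolygon.cv β p m)) := by
  set Λ := OrbitPolygon.loop β p δ with hΛ
  have key : ∀ k, i₀ + k ≤ i₁ →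
      connectedComponentIn (A \ range Λ) (meshPoint δ (OrbitPolygon.cv β p (i₀ + k))) =
        connectedComponentIn (A \ range Λ) (meshPoint δ (OrbitPolygon.cv β p i₀)) := by
    intro k
    induction k with
    | zero => intro; rfl
    | succ k ih =>
      intro hk
      rw [← ih (by omega), show i₀ + (k + 1) = i₀ + k + 1 by omega]
      refine connectedComponentIn_eq ?_
      have hseg : segment ℝ (meshPoint δ (OrbitPolygon.cv β p (i₀ + k)))
          (meshPoint δ (OrbitPolygon.cv β p (i₀ + k + 1))) ⊆ A \ range Λ := by
        intro z hz
        refine ⟨hball (i₀ + k) (by omega) (by omega) ?_,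
          Set.disjoint_left.1 (segment_cv_disjoint_range hp hδ (i₀ + k)) hz⟩
        have h := OrbitPolygon.dist_meshPoint_cv_succ_le (β := β) (p := p) hδ.le (i₀ + k)
        exact (convex_closedBall _ _).segment_subset (mem_closedBall_self hδ.le) (mem_closedBall.2 h) hz
      exact (convex_segment _ _).isPreconnected.subset_connectedComponentIn (right_mem_segment _ _ _) hseg
        (left_mem_segment _ _ _)
  obtain ⟨k, rfl⟩ : ∃ k, i = i₀ + k := ⟨i - i₀, by omega⟩
  obtain ⟨k', rfl⟩ : ∃ k', m = i₀ + k' := ⟨m - i₀, by omega⟩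
  have h1 := key k (by omega)
  have h2 := key k' (by omega)
  have hmem : meshPoint δ (OrbitPolygon.cv β p (i₀ + k)) ∈
      connectedComponentIn (A \ range Λ) (meshPoint δ (OrbitPolygon.cv β p (i₀ + k))) :=
    mem_connectedComponentIn ⟨hball (i₀ + k) (by omega) (by omega) (mem_closedBall_self hδ.le),
      meshPoint_cv_not_mem_range hp hδ _⟩
  rw [h1, ← h2] at hmem
  exact hmem

/-- **The primal chain is open.** Consecutive primal vertices of the orbit are equal or span an open edge
of `β` which is an edge of `ℤ²`. [cite: Smirnov2001, §2] -/
theorem cv_succ_eq_or_mem (j : ℕ) :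
    OrbitPolygon.cv β p j = OrbitPolygon.cv β p (j + 1) ∨
      (s(OrbitPolygon.cv β p j, OrbitPolygon.cv β p (j + 1)) ∈ β ∧
        s(OrbitPolygon.cv β p j, OrbitPolygon.cv β p (j + 1)) ∈ (zdGraph 2).edgeSet) := by
  rcases OrbitPolygon.turn_cases' (β := β) (p := p) (i := j + 1) (Nat.le_add_left 1 j) with
    ⟨hvv, -, -⟩ | ⟨-, -, hedge, hopen⟩
  · rw [Nat.add_sub_cancel] at hvv
    exact Or.inl hvv
  · rw [Nat.add_sub_cancel] at hedge
    have hE : cSrc (OrbitPolygon.corner β p (j + 1)) ∈ (zdGraph 2).edgeSet := by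
      rw [OrbitPolygon.corner_succ, cSrc_nextCorner]; exact cTgt_mem_edgeSet _
    rw [hedge] at hE hopen
    exact Or.inr ⟨hopen, hE⟩

end BondLoopH1

/-- **Registered anchor** (`bondLoopH1_exists_touchPoint`): the component of the primal vertex of a dart of
the orbit, in an open set minus the trace of the rounded loop, touches the trace on that dart.
[cite: AizenmanBurchardDuke1999, Appendix A] -/
theorem bondLoopH1_exists_touchPoint : ∀ (β : BondConfig (Site 2)) (p : Site 2 × Fin 4),
    p ∈ periodicPts (nextCorner β) → ∀ (δ : ℝ), 0 < δ → ∀ (U : Set ℂ) (m : ℕ),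
    closedBall (meshPoint δ (OrbitPolygon.cv β p m)) δ ⊆ U →
    ∃ z ∈ OrbitPolygon.dartPiece β p δ m, dist z (meshPoint δ (OrbitPolygon.cv β p m)) ≤ δ ∧
      z ∈ closure (connectedComponentIn (U \ range (OrbitPolygon.loop β p δ))
        (meshPoint δ (OrbitPolygon.cv β p m))) :=
  fun _ _ hp _ hδ _ m hball ↦ BondLoopH1.exists_touchPoint hp hδ m hball

end Summit.CriticalPhenomena.CardyFormulaZ2.Cruxes.NestingRigidity.PositiveConeWeightDoubling

end
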